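import Summits.Ventures.DiscreteObjects.Hadamard.Order6TypeITools

/-!
# Preparations for the type-I transfer of the order-6 theorem: signed permutations with only 1-, 2₊- and 3₊-cycles

Framing: lottery ticket; floor = certified bounds/negative ranges.

Cell pub-namedobj (venture DiscreteObjects), target (H), hadamard gen 14.  For a signed permutation `(τ, dτ)` of a finite
type all of whose points satisfy `τ² i = i ∧ dτ i · dτ (τ i) = 1` or `τ³ i = i ∧ dτ i · dτ (τ i) · dτ (τ² i) = 1` (fixed points
of sign `+1`, `2`-cycles and `3`-cycles with sign product `+1`), the signed permutation matrix `Q` satisfies `Q⁶ = 1` and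
`Q⁴ + Q³ − Q − 1 = 0` (**`typeI_signedPerm_facts`**) — the hypotheses of `no_hadamard4q_six_typeI_blockform` on the
non-6-cycle part.  Also: powers of a restricted permutation (`subtypePerm_pow_val`) and of a conjugated one
(`conjPerm_pow_apply`), and the count of non-6-cycle points from the numbers of fixed points of `π`, `π²`, `π³`
(`card_not_six_eq`).  Elementary; ours; no `sorry`.
-/

namespace Summit.Ventures.DiscreteObjects.Hadamard

open Finset BigOperators Matrix

section typeIfacts
variable {C : Type*} [Fintype C] [DecidableEq C] {F : Type*} [CommRing F]

/-- **The signed permutation matrix of a signed permutation with only `1₊`-, `2₊`- and `3₊`-cycles satisfies `Q⁶ = 1` and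
`Q⁴ + Q³ − Q − 1 = 0`.** -/
theorem typeI_signedPerm_facts (τ : Equiv.Perm C) (dτ : C → ℤ)
    (htype : ∀ i, (τ (τ i) = i ∧ dτ i * dτ (τ i) = 1) ∨ (τ (τ (τ i)) = i ∧ dτ i * dτ (τ i) * dτ (τ (τ i)) = 1))
    (Q : Matrix C C F) (hQ : Q = fun k i => if k = τ i then ((dτ i : ℤ) : F) else 0) :
    Q ^ 6 = 1 ∧ Q ^ 4 + Q ^ 3 - Q - 1 = 0 := by
  have hpow := signedPermMatrix_pow τ (fun i => ((dτ i : ℤ) : F)) Q hQ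
  have cast3 : ∀ {a b c : ℤ}, a * b * c = 1 → (a : F) * (b : F) * (c : F) = 1 := by
    intro a b c h; have := congrArg (Int.cast : ℤ → F) h; push_cast at this; exact this
  have cast2 : ∀ {a b : ℤ}, a * b = 1 → (a : F) * (b : F) = 1 := by
    intro a b h; have := congrArg (Int.cast : ℤ → F) h; push_cast at this; exact this
  constructor
  · rw [hpow 6]
    ext k i
    rw [Matrix.one_apply]
    rcases htype i with ⟨h2, hs⟩ | ⟨h3, hs⟩
    · have e6 : (τ ^ 6) i = i := by simp [pow_succ, h2]
      have hsF := cast2 hs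
      have eprod : ∏ j ∈ range 6, ((dτ ((τ ^ j) i) : ℤ) : F) = 1 := by
        simp [Finset.prod_range_succ, pow_succ, h2]
        linear_combination (((dτ i : ℤ) : F) * (dτ (τ i) : F) * ((dτ i : F) * (dτ (τ i) : F)) +
          (dτ i : F) * (dτ (τ i) : F) + 1) * hsF
      simp only [e6, eprod]
    · have e6 : (τ ^ 6) i = i := by simp [pow_succ, h3]
      have hsF := cast3 hs
      have eprod : ∏ j ∈ range 6, ((dτ ((τ ^ j) i) : ℤ) : F) = 1 := by
        simp [Finset.prod_range_succ, pow_succ, h3]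
        linear_combination ((dτ i : F) * (dτ (τ i) : F) * (dτ (τ (τ i)) : F) + 1) * hsF
      simp only [e6, eprod]
  · rw [hpow 4, hpow 3, hQ]
    ext k i
    simp only [Matrix.add_apply, Matrix.sub_apply, Matrix.one_apply, Matrix.zero_apply]
    rcases htype i with ⟨h2, hs⟩ | ⟨h3, hs⟩
    · have e4 : (τ ^ 4) i = i := by simp [pow_succ, h2]
      have e3 : (τ ^ 3) i = τ i := by simp [pow_succ, h2]
      have hsF := cast2 hs
      have p4 : ∏ j ∈ range 4, ((dτ ((τ ^ j) i) : ℤ) : F) = 1 := by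
        simp [Finset.prod_range_succ, pow_succ, h2]
        linear_combination ((dτ i : F) * (dτ (τ i) : F) + 1) * hsF
      have p3 : ∏ j ∈ range 3, ((dτ ((τ ^ j) i) : ℤ) : F) = ((dτ i : ℤ) : F) := by
        simp [Finset.prod_range_succ, pow_succ, h2]
        linear_combination ((dτ i : F)) * hsF
      rw [e4, e3, p4, p3]
      abel
    · have e4 : (τ ^ 4) i = τ i := by simp [pow_succ, h3]
      have e3 : (τ ^ 3) i = i := by simp [pow_succ, h3]
      have hsF := cast3 hs
      have p4 : ∏ j ∈ range 4, ((dτ ((τ ^ j) i) : ℤ) : F) = ((dτ i : ℤ) : F) := by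
        simp [Finset.prod_range_succ, pow_succ, h3]
        linear_combination ((dτ i : F)) * hsF
      have p3 : ∏ j ∈ range 3, ((dτ ((τ ^ j) i) : ℤ) : F) = 1 := by
        simp [Finset.prod_range_succ, pow_succ]
        exact hsF
      rw [e4, e3, p4, p3]
      abel

end typeIfacts

section permFacts
variable {α β : Type*}

/-- powers of a restricted permutation, on values -/
theorem subtypePerm_pow_val {p : α → Prop} (f : Equiv.Perm α) (h : ∀ x, p (f x) ↔ p x) (n : ℕ) (x : {x // p x}) :
    (((f.subtypePerm h) ^ n) x : α) = (f ^ n) (x : α) := by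
  induction n generalizing x with
  | zero => simp
  | succ n ih => rw [pow_succ', Equiv.Perm.mul_apply, pow_succ', Equiv.Perm.mul_apply, ← ih]; rfl

/-- powers of a conjugated permutation -/
theorem conjPerm_pow_apply (g : α ≃ β) (κ' : Equiv.Perm β) (n : ℕ) (x : α) :
    (((g.trans κ').trans g.symm) ^ n) x = g.symm ((κ' ^ n) (g x)) := by
  induction n generalizing x with
  | zero => simp
  | succ n ih =>
    rw [pow_succ', Equiv.Perm.mul_apply, ih, pow_succ', Equiv.Perm.mul_apply]
    simp

variable [Fintype α] [DecidableEq α]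

/-- counting the non-6-cycle points of a permutation: `#{¬six} + #Fix(π) = #Fix(π²) + #Fix(π³)` -/
theorem card_not_six_eq (π : Equiv.Perm α) :
    (univ.filter (fun i => ¬ (π (π i) ≠ i ∧ π (π (π i)) ≠ i))).card + (univ.filter (fun i => π i = i)).card =
      (univ.filter (fun i => π (π i) = i)).card + (univ.filter (fun i => π (π (π i)) = i)).card := by
  have hU : univ.filter (fun i => ¬ (π (π i) ≠ i ∧ π (π (π i)) ≠ i)) =
      univ.filter (fun i => π (π i) = i) ∪ univ.filter (fun i => π (π (π i)) = i) := by
    ext i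
    simp only [mem_filter, mem_univ, true_and, mem_union]
    tauto
  have hI : univ.filter (fun i => π i = i) =
      univ.filter (fun i => π (π i) = i) ∩ univ.filter (fun i => π (π (π i)) = i) := by
    ext i
    simp only [mem_filter, mem_univ, true_and, mem_inter]
    constructor
    · intro h; exact ⟨by rw [h, h], by rw [h, h, h]⟩
    · rintro ⟨h2, h3⟩
      have : π (π (π i)) = π i := by rw [h2]
      rw [this] at h3
      exact h3
  rw [hU, hI, Finset.card_union_add_card_inter]

end permFacts

end Summit.Ventures.DiscreteObjects.Hadamard
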